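import Mathlib.Tactic.DeriveFintype
import Literature.Computability.Complexity.MapFstMachine
import HarnessLib

/-!
# The truncating pair map `⟨x, y⟩ ↦ ⟨a, y ↾ |u|⟩` (for `x ↦ ⟨a, u⟩`), reading the discarded
# witness two symbols per step (trunk CplxCore)

Machine-level infrastructure for the tree's nondeterministic time classes. `NTIME t`
(`Nondeterministic.lean`) is in verifier form with ONE constant `c` bounding both the admissible
witness length, `|y| ≤ c · t |x| + c`, and the running time of the verifier on the pair-coded
word `boolPair x y` — a word of length `2|x| + 2 + |y|`, i.e. *longer than the time budget* for
maximal witnesses. Hence every membership proof for `NTIME t` (`NP ⊆ NTIME(2ⁿ)`,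
`DTIME ⊆ NTIME`, `EXP ⊆ NEXP`, padding translations) needs a verifier that gets rid of the part
of the witness it does not use *faster than one symbol per step*, which a `TM2` statement can do
(several `pop`s in one step) but none of the tree's machines or machine compilers does
(`Transducers.lean`, `SymbolPrograms.lean`, `MapFstMachine.lean`, `NondeterministicProofs.lean`
all consume one input symbol per step or slower). This file builds that machine once, as a
wrapper around an arbitrary machine `N` producing the kept length as a unary clock:

  on input `boolPair x y`, if `N` maps `x` to `boolPair a u`, the wrapper outputs
  `boolPair a (y ↾ |u|)`                                   (`outputsWithin_truncMapAux_boolPair`)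

within `m + 3|a| + 2|u| + 2|x| + |y| / 2 + 11` steps, `m` the time of `N` — the discarded
`|y| - |u|` symbols cost half a step each. Typical clocks: `N : x ↦ ⟨x, 1^{p(|x|)}⟩` (truncate a
witness to the admissible length of an `NP` presentation: `NP ⊆ NTIME(2ⁿ)`), `N : x ↦ ⟨x, ε⟩`
(ignore the witness: `DTIME(2^{n^k}) ⊆ NTIME(2^{n^k})`, `EXP ⊆ NEXP`), `N : x ↦ ⟨f x, 1^{p(|f x|)}⟩`
(pull a verifier back along a map `f`); these applications are in `NTIMEInclusions.lean`.

## The machine (`TruncMapTM.machine tm e₀ e₁`)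

Given a bundled `tm : Turing.FinTM2` for `N` (input/output alphabets identified with `Bool` by
`e₀`, `e₁`), the wrapper has stacks `tm.K ⊕ Aux` with two extra `Bool` stacks — its own input
stack `IN` and a work stack `S` —, labels `tm.Λ ⊕ Label`, states `tm.σ × Option Bool × Option Bool`
(two registers), output stack `inl tm.k₁`, and control (cf. `MapFstTM.machine`, which parks `y`
on a work stack one symbol per step; here `y` stays on `IN` underneath nothing, because `tm`
runs on its own stacks):

* `read`: pop `IN` two symbols at a time; a doubled bit `bb` of `x` goes to `S`; anything else
  (the separator `01`) ends `x`, leaving `y` on `IN` (`PairFstTM.readSteps`/`readRest`);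
* `restore`: move `S` onto `tm.k₀` (two reversals restore the order), enter `tm` at its main
  label; the statements of `tm` act on the `inl` stacks and the first state component, `halt`
  becoming `goto hdr`; `tm` halts in Mathlib's `haltList` form with `boolPair a u` on `tm.k₁`;
* `hdr`: pop `tm.k₁` two symbols at a time, pushing them on `S`, through the doubled bits of `a`
  up to and including the separator; the clock `u` remains on `tm.k₁`;
* `keep`: pop one clock token and one symbol of `IN`, pushed on `S` — `|u|` rounds;
* `skip`: pop `IN` TWICE per step until it is empty;
* `out`: pour `S` onto `tm.k₁` (restoring the order: `boolPair a (y ↾ |u|)`), reset, halt.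

## Main statements

* `TruncMapTM.iterate_run`: the exact run (`postSteps + n + preSteps`);
* `truncMapAux N`, **`outputsWithin_truncMapAux`** (general input `z`, in terms of
  `(boolUnpair z).1` and `readRest z`), **`outputsWithin_truncMapAux_boolPair`**.

## Proof architecture

As in `MapFstMachine.lean`: stack bookkeeping `mkStk` with `Function.update` lemmas; exact
simulation of translated statements (`stepAux_liftStmt`, `step_cfgM`, `run_cfgM` via
`TM2Comp.iterate_bind_map`); one-step lemmas per control label by `simp`; phase lemmas by
induction with exact step counts (`iterate_read`, `iterate_restore`, `iterate_hdr`,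
`iterate_keep`, `iterate_skip` with `skipSteps i ≤ |i| / 2 + 2`, `iterate_out`); gluing through
`TM2Comp.initList_eq` / `haltList_eq`.

## References

* S. Arora, B. Barak, *Computational Complexity: A Modern Approach*, CUP 2009, §1.3 (machine
  constructions; several tape operations per step), Def. 2.1 and §2.1.2 (verifier form of
  nondeterministic time), Claim 1.6 / §1.2 (linear speed-up is a matter of the alphabet and of
  the operations per step).
* Mathlib, `Mathlib/Computability/TuringMachine/Computable.lean` (`FinTM2`, `initList`,
  `haltList`, `TM2OutputsInTime`).
-/

namespace Literature.Computability.Complexity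

open _root_.Computability PairFstTM

namespace TruncMapTM

open Turing StateTransition Function TM2Comp

/-! ### Auxiliary stacks, control labels, alphabets, states -/

/-- The two auxiliary `Bool` stacks: the input stack `IN` of the wrapper and the work stack `S`.
[folklore] -/
inductive Aux
  | IN
  | S
  deriving DecidableEq, Fintype

/-- The control labels of the wrapper. [folklore] -/
inductive Label
  | read
  | restore
  | hdr
  | keep
  | skip
  | out
  deriving DecidableEq, Fintype

section Machine

variable {K : Type} {G : K → Type} {Λ σ : Type}

/-- Stack alphabets: those of the wrapped machine on `inl`, `Bool` on the auxiliary stacks.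
[folklore] -/
abbrev Alph (G : K → Type) : K ⊕ Aux → Type := fun j =>
  Sum.casesOn (motive := fun _ => Type) j G (fun _ => Bool)

/-- States: a state of the wrapped machine and two `Bool` registers. [folklore] -/
abbrev St (σ : Type) : Type := σ × Option Bool × Option Bool

/-- Reset both registers. [folklore] -/
def clr : St σ → St σ := fun v => (v.1, none, none)

/-- Stack contents from the stacks `T` of the wrapped machine and the contents `s`, `i` of
`S`, `IN`. [folklore] -/
def mkStk (T : ∀ k, List (G k)) (s i : List Bool) : ∀ j : K ⊕ Aux, List (Alph G j)
  | Sum.inl k => T k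
  | Sum.inr Aux.S => s
  | Sum.inr Aux.IN => i

section StkLemmas

variable (T : ∀ k, List (G k)) (s i : List Bool)

/-- Reading a stack of the wrapped machine. [folklore] -/
@[simp] theorem mkStk_inl (k : K) : mkStk T s i (Sum.inl k) = T k := rfl
/-- Reading `S`. [folklore] -/
@[simp] theorem mkStk_S : mkStk T s i (Sum.inr Aux.S) = s := rfl
/-- Reading `IN`. [folklore] -/
@[simp] theorem mkStk_IN : mkStk T s i (Sum.inr Aux.IN) = i := rfl

variable {dKA : DecidableEq (K ⊕ Aux)}

/-- Writing a stack of the wrapped machine (any decidability instance on `K ⊕ Aux`).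
[folklore] -/
@[simp] theorem mkStk_update_inl [DecidableEq K] (k : K) (L : List (G k)) :
    @update _ _ dKA (mkStk T s i) (Sum.inl k) L = mkStk (update T k L) s i := by
  funext j
  rcases j with k' | a
  · rcases eq_or_ne k' k with rfl | h
    · simp
    · rw [update_of_ne (by simpa using h)]; simp [update_of_ne h]
  · rw [update_of_ne (by simp)]; cases a <;> rfl

/-- Writing `S`. [folklore] -/
@[simp] theorem mkStk_update_S (s' : List Bool) :
    @update _ _ dKA (mkStk T s i) (Sum.inr Aux.S) s' = mkStk T s' i := by
  funext j
  rcases j with k' | a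
  · rw [update_of_ne (by simp)]; rfl
  · cases a
    · rw [update_of_ne (by simp)]; rfl
    · simp

/-- Writing `IN`. [folklore] -/
@[simp] theorem mkStk_update_IN (i' : List Bool) :
    @update _ _ dKA (mkStk T s i) (Sum.inr Aux.IN) i' = mkStk T s i' := by
  funext j
  rcases j with k' | a
  · rw [update_of_ne (by simp)]; rfl
  · cases a
    · simp
    · rw [update_of_ne (by simp)]; rfl

/-- The empty stack assignment. [folklore] -/
theorem mkStk_bot :
    mkStk (fun k => ([] : List (G k))) [] [] = fun j => ([] : List (Alph G j)) := by
  funext j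
  rcases j with k | a
  · rfl
  · cases a <;> rfl

/-- A single-stack assignment of the wrapped machine, embedded. [folklore] -/
theorem mkStk_bot_inl [DecidableEq K] (k : K) (L : List (G k)) :
    mkStk (update (fun k => ([] : List (G k))) k L) [] [] =
      update (fun j => ([] : List (Alph G j))) (Sum.inl k) L := by
  rw [← mkStk_bot, mkStk_update_inl]

/-- The input assignment of the wrapper, embedded. [folklore] -/
theorem mkStk_bot_IN (i : List Bool) :
    mkStk (fun k => ([] : List (G k))) [] i =
      @update _ _ dKA (fun j => ([] : List (Alph G j))) (Sum.inr Aux.IN) i := by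
  rw [← mkStk_bot, mkStk_update_IN]

end StkLemmas

/-- Translation of the statements of the wrapped machine: act on the `inl` stacks and the first
state component; `halt` becomes a jump to the control label `hdr`. [folklore] -/
def liftStmt : TM2.Stmt G Λ σ → TM2.Stmt (Alph G) (Λ ⊕ Label) (St σ)
  | TM2.Stmt.push k f q => TM2.Stmt.push (Sum.inl k) (fun v => f v.1) (liftStmt q)
  | TM2.Stmt.peek k f q => TM2.Stmt.peek (Sum.inl k) (fun v a => (f v.1 a, v.2)) (liftStmt q)
  | TM2.Stmt.pop k f q => TM2.Stmt.pop (Sum.inl k) (fun v a => (f v.1 a, v.2)) (liftStmt q)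
  | TM2.Stmt.load f q => TM2.Stmt.load (fun v => (f v.1, v.2)) (liftStmt q)
  | TM2.Stmt.branch p q₁ q₂ => TM2.Stmt.branch (fun v => p v.1) (liftStmt q₁) (liftStmt q₂)
  | TM2.Stmt.goto l => TM2.Stmt.goto fun v => Sum.inl (l v.1)
  | TM2.Stmt.halt => TM2.Stmt.goto fun _ => Sum.inr Label.hdr

/-- Embedded configuration of the wrapped machine while it runs (`S` empty, the rest of the
input parked on `IN`; the halting label is sent to `hdr`). [folklore] -/
def embed (c : TM2.Cfg G Λ σ) (i : List Bool) : TM2.Cfg (Alph G) (Λ ⊕ Label) (St σ) :=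
  ⟨some (c.l.elim (Sum.inr Label.hdr) Sum.inl), (c.var, none, none), mkStk c.stk [] i⟩

/-- One statement of the wrapped machine is simulated exactly by its translation. [folklore] -/
theorem stepAux_liftStmt [DecidableEq K] (q : TM2.Stmt G Λ σ) (v : σ) (T : ∀ k, List (G k))
    (i : List Bool) :
    TM2.stepAux (liftStmt q) (v, none, none) (mkStk T [] i) = embed (TM2.stepAux q v T) i := by
  induction q generalizing v T with
  | push k f q ih =>
    simp only [liftStmt, TM2.stepAux]
    rw [← ih, mkStk_inl, mkStk_update_inl]
  | peek k f q ih => simp only [liftStmt, TM2.stepAux]; exact ih _ _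
  | pop k f q ih =>
    simp only [liftStmt, TM2.stepAux]
    rw [← ih, mkStk_inl, mkStk_update_inl]
  | load f q ih => simp only [liftStmt, TM2.stepAux]; exact ih _ _
  | branch p q₁ q₂ ih₁ ih₂ =>
    simp only [liftStmt, TM2.stepAux]
    cases p v
    · exact ih₂ _ _
    · exact ih₁ _ _
  | goto l => rfl
  | halt => rfl

/-- Both registers hold a symbol. [folklore] -/
def bothSome : Option Bool → Option Bool → Bool
  | some _, some _ => true
  | _, _ => false

variable (k₀ k₁ : K) (e₀ : G k₀ ≃ Bool) (e₁ : G k₁ ≃ Bool) (main : Λ) (init : σ)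

/-- The control statements (see the module docstring); every control statement resets the
registers before jumping. [cite: AroraBarakCC2009, §1.3] -/
def ctrlStmt : Label → TM2.Stmt (Alph G) (Λ ⊕ Label) (St σ)
  | Label.read =>
      TM2.Stmt.pop (Sum.inr Aux.IN) (fun v a => (v.1, a, v.2.2)) <|
        TM2.Stmt.pop (Sum.inr Aux.IN) (fun v a => (v.1, v.2.1, a)) <|
          TM2.Stmt.branch (fun v => pairOK v.2.1 v.2.2)
            (TM2.Stmt.push (Sum.inr Aux.S) (fun v => v.2.1.getD false) <| TM2.Stmt.load clr <|
              TM2.Stmt.goto fun _ => Sum.inr Label.read)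
            (TM2.Stmt.load clr <| TM2.Stmt.goto fun _ => Sum.inr Label.restore)
  | Label.restore =>
      TM2.Stmt.pop (Sum.inr Aux.S) (fun v a => (v.1, a, none)) <|
        TM2.Stmt.branch (fun v => v.2.1.isSome)
          (TM2.Stmt.push (Sum.inl k₀) (fun v => e₀.symm (v.2.1.getD false)) <|
            TM2.Stmt.load clr <| TM2.Stmt.goto fun _ => Sum.inr Label.restore)
          (TM2.Stmt.load clr <| TM2.Stmt.goto fun _ => Sum.inl main)
  | Label.hdr =>
      TM2.Stmt.pop (Sum.inl k₁) (fun v a => (v.1, a.map e₁, v.2.2)) <|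
        TM2.Stmt.pop (Sum.inl k₁) (fun v a => (v.1, v.2.1, a.map e₁)) <|
          TM2.Stmt.branch (fun v => bothSome v.2.1 v.2.2)
            (TM2.Stmt.push (Sum.inr Aux.S) (fun v => v.2.1.getD false) <|
              TM2.Stmt.push (Sum.inr Aux.S) (fun v => v.2.2.getD false) <|
                TM2.Stmt.branch (fun v => pairOK v.2.1 v.2.2)
                  (TM2.Stmt.load clr <| TM2.Stmt.goto fun _ => Sum.inr Label.hdr)
                  (TM2.Stmt.load clr <| TM2.Stmt.goto fun _ => Sum.inr Label.keep))
            (TM2.Stmt.load clr <| TM2.Stmt.goto fun _ => Sum.inr Label.keep)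
  | Label.keep =>
      TM2.Stmt.pop (Sum.inl k₁) (fun v a => (v.1, a.map e₁, none)) <|
        TM2.Stmt.branch (fun v => v.2.1.isSome)
          (TM2.Stmt.pop (Sum.inr Aux.IN) (fun v a => (v.1, v.2.1, a)) <|
            TM2.Stmt.branch (fun v => v.2.2.isSome)
              (TM2.Stmt.push (Sum.inr Aux.S) (fun v => v.2.2.getD false) <| TM2.Stmt.load clr <|
                TM2.Stmt.goto fun _ => Sum.inr Label.keep)
              (TM2.Stmt.load clr <| TM2.Stmt.goto fun _ => Sum.inr Label.keep))
          (TM2.Stmt.load clr <| TM2.Stmt.goto fun _ => Sum.inr Label.skip)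
  | Label.skip =>
      TM2.Stmt.pop (Sum.inr Aux.IN) (fun v a => (v.1, a, none)) <|
        TM2.Stmt.pop (Sum.inr Aux.IN) (fun v a => (v.1, v.2.1, a)) <|
          TM2.Stmt.branch (fun v => v.2.1.isSome)
            (TM2.Stmt.load clr <| TM2.Stmt.goto fun _ => Sum.inr Label.skip)
            (TM2.Stmt.load clr <| TM2.Stmt.goto fun _ => Sum.inr Label.out)
  | Label.out =>
      TM2.Stmt.pop (Sum.inr Aux.S) (fun v a => (v.1, a, none)) <|
        TM2.Stmt.branch (fun v => v.2.1.isSome)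
          (TM2.Stmt.push (Sum.inl k₁) (fun v => e₁.symm (v.2.1.getD false)) <|
            TM2.Stmt.load clr <| TM2.Stmt.goto fun _ => Sum.inr Label.out)
          (TM2.Stmt.load (fun _ => (init, none, none)) TM2.Stmt.halt)

end Machine

/-! ### Bundling: the wrapper as a `FinTM2` -/

section Bundled

variable (tm : FinTM2) (e₀ : tm.Γ tm.k₀ ≃ Bool) (e₁ : tm.Γ tm.k₁ ≃ Bool)

/-- The program of the wrapper: translated statements of `tm` on `inl`, control statements on
`inr`. [folklore] -/
def prog : tm.Λ ⊕ Label → TM2.Stmt (Alph tm.Γ) (tm.Λ ⊕ Label) (St tm.σ)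
  | Sum.inl l => liftStmt (tm.m l)
  | Sum.inr c => ctrlStmt tm.k₀ tm.k₁ e₀ e₁ tm.main tm.initialState c

/-- **The truncating wrapper** of `tm` (input/output alphabets of `tm` identified with `Bool` by
`e₀`, `e₁`): on input `boolPair x y`, if `tm` maps `x` to `boolPair a u`, it outputs
`boolPair a (y ↾ |u|)`, consuming the discarded part of `y` two symbols per step.
[cite: AroraBarakCC2009, §1.3] -/
def machine : FinTM2 :=
  letI := tm.kFin; letI := tm.ΛFin; letI := tm.σFin
  { K := tm.K ⊕ Aux
    k₀ := Sum.inr Aux.IN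
    k₁ := Sum.inl tm.k₁
    Γ := Alph tm.Γ
    Λ := tm.Λ ⊕ Label
    main := Sum.inr Label.read
    σ := St tm.σ
    initialState := (tm.initialState, none, none)
    Γk₀Fin := show Fintype Bool from inferInstance
    m := prog tm e₀ e₁ }

/-- The step function of the wrapper, with the canonical instances. [folklore] -/
theorem machine_step (c : (machine tm e₀ e₁).Cfg) :
    (machine tm e₀ e₁).step c = TM2.step (prog tm e₀ e₁) c := rfl

/-- Configurations with reset registers, from the label, the `tm`-state, the stacks of `tm` and
the two auxiliary stacks. [folklore] -/
def cfg (l : Option (tm.Λ ⊕ Label)) (v : tm.σ) (T : ∀ k, List (tm.Γ k)) (s i : List Bool) :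
    (machine tm e₀ e₁).Cfg :=
  ⟨l, (v, none, none), mkStk T s i⟩

/-- Configuration of the wrapper while `tm` runs, from a configuration of `tm` and the parked
rest of the input. [folklore] -/
def cfgM (c : tm.Cfg) (i : List Bool) : (machine tm e₀ e₁).Cfg :=
  embed c i

/-- The stacks of `tm` holding the word `w` on `k₀`. [folklore] -/
def inK₀ (w : List Bool) : ∀ k, List (tm.Γ k) :=
  update (fun _ => []) tm.k₀ (w.map e₀.symm)

/-- The stacks of `tm` holding the word `w` on `k₁`. [folklore] -/
def inK₁ (w : List Bool) : ∀ k, List (tm.Γ k) :=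
  update (fun _ => []) tm.k₁ (w.map e₁.symm)

/-! ### Single steps of the control labels -/

section Steps

variable (v : tm.σ) (T : ∀ k, List (tm.Γ k)) (s i : List Bool)

/-- `read` on a doubled bit `bb`: push `b` on `S`. [folklore] -/
theorem step_read_cons_cons_self (b : Bool) (rest : List Bool) :
    (machine tm e₀ e₁).step
        (cfg tm e₀ e₁ (some (Sum.inr Label.read)) v T s (b :: b :: rest)) =
      some (cfg tm e₀ e₁ (some (Sum.inr Label.read)) v T (b :: s) rest) := by
  rw [machine_step]; simp [cfg, TM2.step, prog, TM2.stepAux, ctrlStmt, clr, pairOK]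
  rfl

/-- `read` on an unequal pair (separator or junk): the first component has ended. [folklore] -/
theorem step_read_cons_cons_ne {b b' : Bool} (h : b ≠ b') (rest : List Bool) :
    (machine tm e₀ e₁).step
        (cfg tm e₀ e₁ (some (Sum.inr Label.read)) v T s (b :: b' :: rest)) =
      some (cfg tm e₀ e₁ (some (Sum.inr Label.restore)) v T s rest) := by
  rw [machine_step]; simp [cfg, TM2.step, prog, TM2.stepAux, ctrlStmt, clr, pairOK, h]
  rfl

/-- `read` on a single leftover symbol. [folklore] -/
theorem step_read_single (b : Bool) :
    (machine tm e₀ e₁).step (cfg tm e₀ e₁ (some (Sum.inr Label.read)) v T s [b]) =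
      some (cfg tm e₀ e₁ (some (Sum.inr Label.restore)) v T s []) := by
  rw [machine_step]; simp [cfg, TM2.step, prog, TM2.stepAux, ctrlStmt, clr, pairOK]
  rfl

/-- `read` on empty input. [folklore] -/
theorem step_read_nil :
    (machine tm e₀ e₁).step (cfg tm e₀ e₁ (some (Sum.inr Label.read)) v T s []) =
      some (cfg tm e₀ e₁ (some (Sum.inr Label.restore)) v T s []) := by
  rw [machine_step]; simp [cfg, TM2.step, prog, TM2.stepAux, ctrlStmt, clr, pairOK]
  rfl

/-- `restore` on nonempty `S`: move one bit to `k₀` of `tm` (through `e₀.symm`). [folklore] -/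
theorem step_restore_cons (b : Bool) (u : List Bool) :
    (machine tm e₀ e₁).step
        (cfg tm e₀ e₁ (some (Sum.inr Label.restore)) v (inK₀ tm e₀ u) (b :: s) i) =
      some (cfg tm e₀ e₁ (some (Sum.inr Label.restore)) v (inK₀ tm e₀ (b :: u)) s i) := by
  rw [machine_step]; simp [cfg, TM2.step, prog, TM2.stepAux, ctrlStmt, clr, inK₀]
  rfl

/-- `restore` on empty `S`: enter `tm` at its main label. [folklore] -/
theorem step_restore_nil (u : List Bool) :
    (machine tm e₀ e₁).step (cfg tm e₀ e₁ (some (Sum.inr Label.restore)) v (inK₀ tm e₀ u) [] i) =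
      some (cfg tm e₀ e₁ (some (Sum.inl tm.main)) v (inK₀ tm e₀ u) [] i) := by
  rw [machine_step]; simp [cfg, TM2.step, prog, TM2.stepAux, ctrlStmt, clr]
  rfl

/-- `hdr` on a doubled bit `bb` of the output of `tm`: push `b`, `b` on `S`. [folklore] -/
theorem step_hdr_cons_cons_self (b : Bool) (w : List Bool) :
    (machine tm e₀ e₁).step
        (cfg tm e₀ e₁ (some (Sum.inr Label.hdr)) v (inK₁ tm e₁ (b :: b :: w)) s i) =
      some (cfg tm e₀ e₁ (some (Sum.inr Label.hdr)) v (inK₁ tm e₁ w) (b :: b :: s) i) := by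
  rw [machine_step]
  simp [cfg, TM2.step, prog, TM2.stepAux, ctrlStmt, clr, inK₁, pairOK, bothSome]
  rfl

/-- `hdr` on an unequal pair (the separator): push it on `S` and proceed to `keep`. [folklore] -/
theorem step_hdr_cons_cons_ne {b b' : Bool} (h : b ≠ b') (w : List Bool) :
    (machine tm e₀ e₁).step
        (cfg tm e₀ e₁ (some (Sum.inr Label.hdr)) v (inK₁ tm e₁ (b :: b' :: w)) s i) =
      some (cfg tm e₀ e₁ (some (Sum.inr Label.keep)) v (inK₁ tm e₁ w) (b' :: b :: s) i) := by
  rw [machine_step]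
  simp [cfg, TM2.step, prog, TM2.stepAux, ctrlStmt, clr, inK₁, pairOK, bothSome, h]
  rfl

/-- `hdr` on a single leftover symbol (malformed output): proceed to `keep`. [folklore] -/
theorem step_hdr_single (b : Bool) :
    (machine tm e₀ e₁).step (cfg tm e₀ e₁ (some (Sum.inr Label.hdr)) v (inK₁ tm e₁ [b]) s i) =
      some (cfg tm e₀ e₁ (some (Sum.inr Label.keep)) v (inK₁ tm e₁ []) s i) := by
  rw [machine_step]
  simp [cfg, TM2.step, prog, TM2.stepAux, ctrlStmt, clr, inK₁, bothSome]
  rfl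

/-- `hdr` on empty output (malformed): proceed to `keep`. [folklore] -/
theorem step_hdr_nil :
    (machine tm e₀ e₁).step (cfg tm e₀ e₁ (some (Sum.inr Label.hdr)) v (inK₁ tm e₁ []) s i) =
      some (cfg tm e₀ e₁ (some (Sum.inr Label.keep)) v (inK₁ tm e₁ []) s i) := by
  rw [machine_step]
  simp [cfg, TM2.step, prog, TM2.stepAux, ctrlStmt, clr, inK₁, bothSome]
  rfl

/-- `keep` with a clock token and an input symbol: keep the symbol on `S`. [folklore] -/
theorem step_keep_cons_cons (c : Bool) (w : List Bool) (b : Bool) (i : List Bool) :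
    (machine tm e₀ e₁).step
        (cfg tm e₀ e₁ (some (Sum.inr Label.keep)) v (inK₁ tm e₁ (c :: w)) s (b :: i)) =
      some (cfg tm e₀ e₁ (some (Sum.inr Label.keep)) v (inK₁ tm e₁ w) (b :: s) i) := by
  rw [machine_step]
  simp [cfg, TM2.step, prog, TM2.stepAux, ctrlStmt, clr, inK₁]
  rfl

/-- `keep` with a clock token and no input left: drain the clock. [folklore] -/
theorem step_keep_cons_nil (c : Bool) (w : List Bool) :
    (machine tm e₀ e₁).step
        (cfg tm e₀ e₁ (some (Sum.inr Label.keep)) v (inK₁ tm e₁ (c :: w)) s []) =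
      some (cfg tm e₀ e₁ (some (Sum.inr Label.keep)) v (inK₁ tm e₁ w) s []) := by
  rw [machine_step]
  simp [cfg, TM2.step, prog, TM2.stepAux, ctrlStmt, clr, inK₁]
  rfl

/-- `keep` with the clock exhausted: proceed to `skip`. [folklore] -/
theorem step_keep_nil :
    (machine tm e₀ e₁).step (cfg tm e₀ e₁ (some (Sum.inr Label.keep)) v (inK₁ tm e₁ []) s i) =
      some (cfg tm e₀ e₁ (some (Sum.inr Label.skip)) v (inK₁ tm e₁ []) s i) := by
  rw [machine_step]
  simp [cfg, TM2.step, prog, TM2.stepAux, ctrlStmt, clr, inK₁]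
  rfl

/-- `skip` on two input symbols: discard both in ONE step. [folklore] -/
theorem step_skip_cons_cons (b b' : Bool) (i : List Bool) :
    (machine tm e₀ e₁).step (cfg tm e₀ e₁ (some (Sum.inr Label.skip)) v T s (b :: b' :: i)) =
      some (cfg tm e₀ e₁ (some (Sum.inr Label.skip)) v T s i) := by
  rw [machine_step]
  simp [cfg, TM2.step, prog, TM2.stepAux, ctrlStmt, clr]
  rfl

/-- `skip` on a single input symbol: discard it. [folklore] -/
theorem step_skip_single (b : Bool) :
    (machine tm e₀ e₁).step (cfg tm e₀ e₁ (some (Sum.inr Label.skip)) v T s [b]) =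
      some (cfg tm e₀ e₁ (some (Sum.inr Label.skip)) v T s []) := by
  rw [machine_step]
  simp [cfg, TM2.step, prog, TM2.stepAux, ctrlStmt, clr]
  rfl

/-- `skip` on empty input: proceed to `out`. [folklore] -/
theorem step_skip_nil :
    (machine tm e₀ e₁).step (cfg tm e₀ e₁ (some (Sum.inr Label.skip)) v T s []) =
      some (cfg tm e₀ e₁ (some (Sum.inr Label.out)) v T s []) := by
  rw [machine_step]
  simp [cfg, TM2.step, prog, TM2.stepAux, ctrlStmt, clr]
  rfl

/-- `out` on nonempty `S`: move one bit to `k₁` (through `e₁.symm`). [folklore] -/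
theorem step_out_cons (b : Bool) :
    (machine tm e₀ e₁).step (cfg tm e₀ e₁ (some (Sum.inr Label.out)) v T (b :: s) i) =
      some (cfg tm e₀ e₁ (some (Sum.inr Label.out)) v (update T tm.k₁ (e₁.symm b :: T tm.k₁))
        s i) := by
  rw [machine_step]
  simp [cfg, TM2.step, prog, TM2.stepAux, ctrlStmt, clr]
  rfl

/-- `out` on empty `S`: reset the state and halt. [folklore] -/
theorem step_out_nil :
    (machine tm e₀ e₁).step (cfg tm e₀ e₁ (some (Sum.inr Label.out)) v T [] i) =
      some (cfg tm e₀ e₁ none tm.initialState T [] i) := by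
  rw [machine_step]
  simp [cfg, TM2.step, prog, TM2.stepAux, ctrlStmt]
  rfl

/-- A step of `tm` is a step of the wrapper on the embedded configuration. [folklore] -/
theorem step_cfgM (a b : tm.Cfg) (h : tm.step a = some b) (i : List Bool) :
    (machine tm e₀ e₁).step (cfgM tm e₀ e₁ a i) = some (cfgM tm e₀ e₁ b i) := by
  obtain ⟨_ | l, w, T'⟩ := a
  · simp [FinTM2.step, TM2.step] at h
  · simp only [FinTM2.step, TM2.step] at h
    obtain rfl := Option.some.inj h
    rw [machine_step]
    simp only [cfgM, embed, TM2.step, prog, Option.elim, stepAux_liftStmt]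
    rfl

end Steps

/-! ### Phases -/

section Phases

variable (v : tm.σ)

/-- The `read` phase: `(boolUnpair z).1` (reversed) onto `S`, `readRest z` left on `IN`.
[folklore] -/
theorem iterate_read (T : ∀ k, List (tm.Γ k)) :
    ∀ z s : List Bool,
      (flip bind (machine tm e₀ e₁).step)^[readSteps z]
          (some (cfg tm e₀ e₁ (some (Sum.inr Label.read)) v T s z)) =
        some (cfg tm e₀ e₁ (some (Sum.inr Label.restore)) v T
          ((boolUnpair z).1.reverse ++ s) (readRest z))
  | [], s => by
    simp only [readSteps, iterate_one, readRest, boolUnpair_fst_nil, List.reverse_nil,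
      List.nil_append]
    exact step_read_nil tm e₀ e₁ v T s
  | [b], s => by
    simp only [readSteps, iterate_one, readRest, boolUnpair_fst_single, List.reverse_nil,
      List.nil_append]
    exact step_read_single tm e₀ e₁ v T s b
  | b :: b' :: rest, s => by
    by_cases h : b = b'
    · subst h
      simp only [readSteps, readRest, boolUnpair_fst_cons_cons, if_true]
      rw [iterate_bind_succ, step_read_cons_cons_self, iterate_read T rest (b :: s)]
      simp
    · simp only [readSteps, readRest, boolUnpair_fst_cons_cons, if_neg h, iterate_one,
        List.reverse_nil, List.nil_append]
      exact step_read_cons_cons_ne tm e₀ e₁ v T s h rest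

/-- The `restore` phase: `S` (reversed) onto `k₀` of `tm`, then enter `tm`. [folklore] -/
theorem iterate_restore (i : List Bool) :
    ∀ s u : List Bool,
      (flip bind (machine tm e₀ e₁).step)^[s.length + 1]
          (some (cfg tm e₀ e₁ (some (Sum.inr Label.restore)) v (inK₀ tm e₀ u) s i)) =
        some (cfg tm e₀ e₁ (some (Sum.inl tm.main)) v (inK₀ tm e₀ (s.reverse ++ u)) [] i)
  | [], u => by
    rw [List.length_nil, Nat.zero_add, iterate_bind_succ, step_restore_nil]; rfl
  | b :: s, u => by
    rw [List.length_cons, iterate_bind_succ, step_restore_cons, iterate_restore i s (b :: u)]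
    simp

/-- The `hdr` phase on a well-formed output `boolPair a u` of `tm`: the doubled bits of `a`
and the separator (reversed) onto `S`, the clock `u` left on `k₁`. [folklore] -/
theorem iterate_hdr (i : List Bool) :
    ∀ a u s : List Bool,
      (flip bind (machine tm e₀ e₁).step)^[a.length + 1]
          (some (cfg tm e₀ e₁ (some (Sum.inr Label.hdr)) v (inK₁ tm e₁ (boolPair a u)) s i)) =
        some (cfg tm e₀ e₁ (some (Sum.inr Label.keep)) v (inK₁ tm e₁ u)
          (((a.flatMap fun b => [b, b]) ++ [false, true]).reverse ++ s) i)
  | [], u, s => by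
    have hb : boolPair [] u = false :: true :: u := by simp [boolPair]
    rw [List.length_nil, Nat.zero_add, iterate_one, hb]
    refine (step_hdr_cons_cons_ne tm e₀ e₁ v s i Bool.false_ne_true u).trans ?_
    simp
  | b :: a, u, s => by
    have hb : boolPair (b :: a) u = b :: b :: boolPair a u := by simp [boolPair]
    rw [List.length_cons, iterate_bind_succ, hb, step_hdr_cons_cons_self, iterate_hdr i a u (b :: b :: s)]
    simp

/-- The `keep` phase: the first `|u|` symbols of the parked input (reversed) onto `S`, one
clock token each. [folklore] -/
theorem iterate_keep (s : List Bool) :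
    ∀ u i : List Bool,
      (flip bind (machine tm e₀ e₁).step)^[u.length + 1]
          (some (cfg tm e₀ e₁ (some (Sum.inr Label.keep)) v (inK₁ tm e₁ u) s i)) =
        some (cfg tm e₀ e₁ (some (Sum.inr Label.skip)) v (inK₁ tm e₁ [])
          ((i.take u.length).reverse ++ s) (i.drop u.length))
  | [], i => by
    rw [List.length_nil, Nat.zero_add, iterate_one]
    refine (step_keep_nil tm e₀ e₁ v s i).trans ?_
    simp
  | c :: u, [] => by
    rw [List.length_cons, iterate_bind_succ, step_keep_cons_nil, iterate_keep s u []]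
    simp
  | c :: u, b :: i => by
    rw [List.length_cons, iterate_bind_succ, step_keep_cons_cons]
    have := iterate_keep (b :: s) u i
    rw [this]
    simp

/-- Steps of the `skip` phase on the remaining input `i` (two symbols per step). [folklore] -/
def skipSteps : List Bool → ℕ
  | [] => 1
  | [_] => 2
  | _ :: _ :: i => skipSteps i + 1

/-- `skipSteps i ≤ |i| / 2 + 2`. [folklore] -/
theorem skipSteps_le : ∀ i : List Bool, skipSteps i ≤ i.length / 2 + 2
  | [] => by simp [skipSteps]
  | [_] => by simp [skipSteps]
  | _ :: _ :: i => by
    have := skipSteps_le i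
    simp only [skipSteps, List.length_cons]
    omega

/-- The `skip` phase: discard the remaining input, two symbols per step. [folklore] -/
theorem iterate_skip (T : ∀ k, List (tm.Γ k)) (s : List Bool) :
    ∀ i : List Bool,
      (flip bind (machine tm e₀ e₁).step)^[skipSteps i]
          (some (cfg tm e₀ e₁ (some (Sum.inr Label.skip)) v T s i)) =
        some (cfg tm e₀ e₁ (some (Sum.inr Label.out)) v T s [])
  | [] => by
    rw [skipSteps, iterate_one]
    exact step_skip_nil tm e₀ e₁ v T s
  | [b] => by
    rw [skipSteps, show (2 : ℕ) = 1 + 1 from rfl, iterate_bind_succ, step_skip_single,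
      iterate_one]
    exact step_skip_nil tm e₀ e₁ v T s
  | b :: b' :: i => by
    rw [skipSteps, iterate_bind_succ, step_skip_cons_cons]
    exact iterate_skip T s i

/-- The `out` phase: `S` (reversed, through `e₁.symm`) onto `k₁`, then halt. [folklore] -/
theorem iterate_out (i : List Bool) :
    ∀ (s : List Bool) (T : ∀ k, List (tm.Γ k)),
      (flip bind (machine tm e₀ e₁).step)^[s.length + 1]
          (some (cfg tm e₀ e₁ (some (Sum.inr Label.out)) v T s i)) =
        some (cfg tm e₀ e₁ none tm.initialState
          (update T tm.k₁ (s.reverse.map e₁.symm ++ T tm.k₁)) [] i)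
  | [], T => by
    rw [List.length_nil, Nat.zero_add, iterate_bind_succ, step_out_nil]; simp
  | b :: s, T => by
    rw [List.length_cons, iterate_bind_succ, step_out_cons,
      iterate_out i s (update T tm.k₁ (e₁.symm b :: T tm.k₁)), update_idem, update_self]
    simp

/-- A run of `tm` is a run of the wrapper on embedded configurations. [folklore] -/
theorem run_cfgM {n : ℕ} {a b : tm.Cfg} (h : (flip bind tm.step)^[n] (some a) = some b)
    (i : List Bool) :
    (flip bind (machine tm e₀ e₁).step)^[n] (some (cfgM tm e₀ e₁ a i)) =
      some (cfgM tm e₀ e₁ b i) :=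
  iterate_bind_map tm.step (machine tm e₀ e₁).step (fun c => cfgM tm e₀ e₁ c i)
    (fun c d hcd => step_cfgM tm e₀ e₁ c d hcd i) n a b h

end Phases

/-! ### Gluing: initial and halting configurations -/

/-- The initial configuration of the wrapper on the word `z`. [folklore] -/
theorem initList_machine (z : List Bool) :
    initList (machine tm e₀ e₁) z =
      cfg tm e₀ e₁ (some (Sum.inr Label.read)) tm.initialState (fun _ => []) [] z := by
  rw [initList_eq]
  change (⟨some (Sum.inr Label.read), (tm.initialState, none, none),
      update (fun j => ([] : List (Alph tm.Γ j))) (Sum.inr Aux.IN) z⟩ :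
      TM2.Cfg (Alph tm.Γ) (tm.Λ ⊕ Label) (St tm.σ)) = _
  rw [← mkStk_bot_IN]
  rfl

/-- The halting configuration of the wrapper with output `L`. [folklore] -/
theorem haltList_machine (L : List (tm.Γ tm.k₁)) :
    haltList (machine tm e₀ e₁) L =
      cfg tm e₀ e₁ none tm.initialState (update (fun _ => []) tm.k₁ L) [] [] := by
  rw [haltList_eq]
  change (⟨none, (tm.initialState, none, none),
      update (fun j => ([] : List (Alph tm.Γ j))) (Sum.inl tm.k₁) L⟩ :
      TM2.Cfg (Alph tm.Γ) (tm.Λ ⊕ Label) (St tm.σ)) = _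
  rw [← mkStk_bot_inl]
  rfl

/-- The embedded initial configuration of `tm` on the word `w`, with `i` parked. [folklore] -/
theorem cfgM_initList (w i : List Bool) :
    cfgM tm e₀ e₁ (initList tm (w.map e₀.symm)) i =
      cfg tm e₀ e₁ (some (Sum.inl tm.main)) tm.initialState (inK₀ tm e₀ w) [] i := by
  rw [initList_eq]; rfl

/-- The embedded halting configuration of `tm` with output word `o`: the wrapper is at `hdr`.
[folklore] -/
theorem cfgM_haltList (o i : List Bool) :
    cfgM tm e₀ e₁ (haltList tm (o.map e₁.symm)) i =
      cfg tm e₀ e₁ (some (Sum.inr Label.hdr)) tm.initialState (inK₁ tm e₁ o) [] i := by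
  rw [haltList_eq]; rfl

/-! ### The whole run -/

/-- Steps of the preprocessing (`read`, `restore`). [folklore] -/
def preSteps (z : List Bool) : ℕ :=
  ((boolUnpair z).1.length + 1) + readSteps z

/-- **Preprocessing.** From the initial configuration on `z` the wrapper reaches the embedded
initial configuration of `tm` on `(boolUnpair z).1`, with `readRest z` parked on `IN`, in
`preSteps z` steps. [folklore] -/
theorem iterate_pre (z : List Bool) :
    (flip bind (machine tm e₀ e₁).step)^[preSteps z] (some (initList (machine tm e₀ e₁) z)) =
      some (cfgM tm e₀ e₁ (initList tm ((boolUnpair z).1.map e₀.symm)) (readRest z)) := by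
  have hl : (boolUnpair z).1.length = (boolUnpair z).1.reverse.length := by simp
  have h0 : (fun _ : tm.K => ([] : List (tm.Γ _))) = inK₀ tm e₀ [] := by simp [inK₀]
  rw [initList_machine, h0, preSteps, iterate_add_apply, iterate_read, List.append_nil, hl,
    iterate_restore, List.reverse_reverse, List.append_nil, cfgM_initList]

/-- Steps of the postprocessing (`hdr`, `keep`, `skip`, `out`) for output `boolPair a u` of
`tm` and parked input `i`. [folklore] -/
def postSteps (a u i : List Bool) : ℕ :=
  ((((i.take u.length).reverse ++ ((a.flatMap fun b => [b, b]) ++ [false, true]).reverse).length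
      + 1) + (skipSteps (i.drop u.length) + ((u.length + 1) + (a.length + 1))))

/-- `postSteps a u i ≤ 3 |a| + 2 |u| + |i| / 2 + 7`. [folklore] -/
theorem postSteps_le (a u i : List Bool) :
    postSteps a u i ≤ 3 * a.length + 2 * u.length + i.length / 2 + 7 := by
  have h1 := skipSteps_le (i.drop u.length)
  have h2 : (i.take u.length).length ≤ u.length := by
    rw [List.length_take]; exact Nat.min_le_left _ _
  have h3 : (i.drop u.length).length / 2 ≤ i.length / 2 :=
    Nat.div_le_div_right (by rw [List.length_drop]; exact Nat.sub_le _ _)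
  have h4 := MapFstTM.length_flatMap_pair a
  simp only [postSteps, List.length_append, List.length_reverse, List.length_cons,
    List.length_nil, h4]
  omega

/-- **Postprocessing.** From the embedded halting configuration of `tm` with output
`boolPair a u` and `i` parked, the wrapper halts with output `boolPair a (i ↾ |u|)` in
`postSteps a u i` steps. [folklore] -/
theorem iterate_post (a u i : List Bool) :
    (flip bind (machine tm e₀ e₁).step)^[postSteps a u i]
        (some (cfgM tm e₀ e₁ (haltList tm ((boolPair a u).map e₁.symm)) i)) =
      some (haltList (machine tm e₀ e₁) ((boolPair a (i.take u.length)).map e₁.symm)) := by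
  rw [cfgM_haltList, postSteps,
    iterate_add_apply _ (((i.take u.length).reverse ++
      ((a.flatMap fun b => [b, b]) ++ [false, true]).reverse).length + 1),
    iterate_add_apply _ (skipSteps (i.drop u.length)),
    iterate_add_apply _ (u.length + 1) (a.length + 1),
    iterate_hdr, iterate_keep, iterate_skip]
  simp only [List.append_nil]
  rw [iterate_out, haltList_machine]
  congr 2
  simp only [inK₁, boolPair, List.map_nil, update_idem, List.reverse_append, List.reverse_reverse,
    List.reverse_cons, List.reverse_nil, List.nil_append, List.append_assoc,
    List.cons_append, List.map_append, List.map_cons, List.map_take, List.append_nil,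
    update_self]
  rfl

/-- **The whole run.** If `tm` maps `(boolUnpair z).1` to `boolPair a u` in `n` steps then the
wrapper maps `z` to `boolPair a ((readRest z) ↾ |u|)` in `postSteps + n + preSteps` steps.
[cite: AroraBarakCC2009, §1.3] -/
theorem iterate_run {z a u : List Bool} {n : ℕ}
    (h : (flip bind tm.step)^[n] (some (initList tm ((boolUnpair z).1.map e₀.symm))) =
      some (haltList tm ((boolPair a u).map e₁.symm))) :
    (flip bind (machine tm e₀ e₁).step)^[postSteps a u (readRest z) + (n + preSteps z)]
        (some (initList (machine tm e₀ e₁) z)) =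
      some (haltList (machine tm e₀ e₁) ((boolPair a ((readRest z).take u.length)).map e₁.symm)) := by
  rw [iterate_add_apply _ (postSteps a u (readRest z)), iterate_add_apply _ n, iterate_pre,
    run_cfgM tm e₀ e₁ h, iterate_post]

end Bundled

end TruncMapTM

/-! ### Exported statements -/

open Turing TruncMapTM TM2Comp

/-- **The truncating wrapper** of `N : TM2ComputableAux Bool Bool`: on `boolPair x y`, if `N`
maps `x` to `boolPair a u`, it outputs `boolPair a (y ↾ |u|)`. [cite: AroraBarakCC2009, §1.3] -/
def truncMapAux (N : TM2ComputableAux Bool Bool) : TM2ComputableAux Bool Bool where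
  tm := TruncMapTM.machine N.tm N.inputAlphabet N.outputAlphabet
  inputAlphabet := Equiv.refl Bool
  outputAlphabet := show N.tm.Γ N.tm.k₁ ≃ Bool from N.outputAlphabet

/-- **Running time of the truncating wrapper**: if `N` outputs `boolPair a u` on
`(boolUnpair z).1` within `m` steps, then `truncMapAux N` outputs
`boolPair a ((readRest z) ↾ |u|)` on `z` within
`m + 3 |a| + 2 |u| + (|z| - |readRest z|) + |readRest z| / 2 + 9` steps — the discarded part of
the input costs HALF a step per symbol. [cite: AroraBarakCC2009, §1.3] -/
theorem outputsWithin_truncMapAux (N : TM2ComputableAux Bool Bool) {z a u : List Bool} {m : ℕ}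
    (h : N.OutputsWithin (boolUnpair z).1 (boolPair a u) m) :
    (truncMapAux N).OutputsWithin z (boolPair a ((readRest z).take u.length))
      (m + 3 * a.length + 2 * u.length + (z.length - (readRest z).length) +
        (readRest z).length / 2 + 9) := by
  obtain ⟨⟨⟨n, hn⟩, hle⟩⟩ := h
  have hpre := readSteps_add_le z
  have hpost := postSteps_le a u (readRest z)
  have hr : (readRest z).length ≤ z.length := by
    have := one_le_readSteps z
    omega
  refine ⟨⟨⟨postSteps a u (readRest z) + (n + TruncMapTM.preSteps z), ?_⟩, ?_⟩⟩
  · have hin : z.map (truncMapAux N).inputAlphabet.symm = z := List.map_id _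
    change (flip bind (truncMapAux N).tm.step)^[_]
        (some (initList (truncMapAux N).tm (z.map (truncMapAux N).inputAlphabet.symm))) =
      some (haltList (truncMapAux N).tm
        ((boolPair a ((readRest z).take u.length)).map (truncMapAux N).outputAlphabet.symm))
    rw [hin]
    exact iterate_run N.tm N.inputAlphabet N.outputAlphabet hn
  · change postSteps a u (readRest z) + (n + TruncMapTM.preSteps z) ≤ _
    change n ≤ m at hle
    unfold TruncMapTM.preSteps
    omega

/-- The case of a well-formed input pair: on `boolPair x y`, if `N` maps `x` to `boolPair a u`
within `m` steps, the wrapper outputs `boolPair a (y ↾ |u|)` within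
`m + 3 |a| + 2 |u| + 2 |x| + |y| / 2 + 11` steps. [cite: AroraBarakCC2009, §1.3] -/
theorem outputsWithin_truncMapAux_boolPair (N : TM2ComputableAux Bool Bool) {x y a u : List Bool}
    {m : ℕ} (h : N.OutputsWithin x (boolPair a u) m) :
    (truncMapAux N).OutputsWithin (boolPair x y) (boolPair a (y.take u.length))
      (m + 3 * a.length + 2 * u.length + 2 * x.length + y.length / 2 + 11) := by
  have h' : N.OutputsWithin (boolUnpair (boolPair x y)).1 (boolPair a u) m := by simpa using h
  have := outputsWithin_truncMapAux N (z := boolPair x y) h'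
  rw [readRest_boolPair] at this
  refine this.mono ?_
  have hl : (boolPair x y).length = 2 * x.length + 2 + y.length := by
    simp [boolPair]; omega
  omega

end Literature.Computability.Complexity
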